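import Summits.ResolutionOfSingularities.ResolutionOfSingularities.Theorems.PerronSigma
import HarnessLib
/-! # PerronSigmaStep — decomp-res node «DefectlessLadder» (lens-1 g19), tree file 2/3 of the Σ₁ part:
`monoidalStepD_holds : MonoidalStepD`
(KERNEL), VERBATIM from the companion `HOME/decomp-res-lens-1/g19/tree/DefectlessLadderTree.lean` (sha256
45a9879c65cfd008…) l. 225–626 — one
≈390-line declaration alone in its file, hence the compressed preamble, a shortened docstring and the 16
step-marker `--` comments removed
(400-line limit); provenance, critic row 145 and the hygiene rationale as in `PerronSigma`.  Supports Valuative 0641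
(helper). -/
noncomputable section
open IsLocalRing Literature.AlgebraicGeometry.Resolution Summit.ResolutionOfSingularities.ResolutionOfSingularities.Theses
open Summit.ResolutionOfSingularities.ResolutionOfSingularities.Theorems
open Summit.ResolutionOfSingularities.ResolutionOfSingularities.Theorems.PfaffLine
open Summit.ResolutionOfSingularities.ResolutionOfSingularities.Theorems.ToricLadder
open Summit.ResolutionOfSingularities.ResolutionOfSingularities.Theorems.KaplanskyLadder
open Summit.ResolutionOfSingularities.ResolutionOfSingularities.Theorems.PerronLadder
namespace Summit.ResolutionOfSingularities.ResolutionOfSingularities.Theorems.DefectlessLadder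
section PartVII
set_option maxHeartbeats 1600000 in
/-- **Σ₁′ IN KERNEL (gen 19): the corrected monoidal step `MonoidalStepD` HOLDS** — the chart `D₊(t_s T)`
of the blow-up of `S` in the
regular centre `(t s, t i)` (tree `BlowupChartRsop` / `QuadraticTransformAlongPrime` / `LocalBlowup`), localised at
the centre of `O`; full
commented proof narrative in the companion (l. 226–237) and the node §28.  0 sorry; axioms standard. -/
theorem monoidalStepD_holds : MonoidalStepD := by
  intro k K _ _ _ O hk F₁ S hS m t ht hdt i s his hvs hvi
  classical
  obtain ⟨hreg, hSO, hSF, hunit, hfrac, C, hCfg, hCS, hCrep⟩ := hS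
  obtain ⟨ht1, d, z, hdim, hzu, hzspan, htz⟩ := ht
  haveI : IsRegularLocalRing S := hreg
  have hSO' : ∀ x : K, x ∈ S → x ∈ O := fun x hx => hSO (Subalgebra.mem_toSubring.mpr hx)
  have hvi1 : O.valuation (t i) < 1 := lt_of_le_of_lt hvi hvs
  have hti0 : t i ≠ 0 := (ht1 i).2
  have hts0 : t s ≠ 0 := (ht1 s).2
  have htis : t i ≠ t s := fun h => his (hdt i s hvi1 h)
  obtain ⟨a, ha⟩ : ∃ j, (z j : K) = t i := (htz i).resolve_right (ne_of_lt hvi1)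
  obtain ⟨b, hb⟩ : ∃ j, (z j : K) = t s := (htz s).resolve_right (ne_of_lt hvs)
  have hab : a ≠ b := fun h => htis (by rw [← ha, ← hb, h])
  have hzm : ∀ j, z j ∈ maximalIdeal S := fun j => (IsLocalRing.mem_maximalIdeal _).mpr (hzu j)
  have hspan : Ideal.span (Set.range z) = maximalIdeal S := by
    refine le_antisymm (Ideal.span_le.mpr ?_)
      fun r hr => hzspan r ((IsLocalRing.mem_maximalIdeal r).mp hr)
    rintro _ ⟨j, rfl⟩
    exact hzm j
  have hfr : (maximalIdeal S).spanFinrank = d := by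
    have h1 : ((maximalIdeal S).spanFinrank : WithBot ℕ∞) = ringKrullDim S :=
      IsRegularLocalRing.spanFinrank_maximalIdeal
    rw [hdim] at h1
    exact_mod_cast h1
  have hnsq : ∀ j j₁ j₂, z j ≠ z j₁ * z j₂ := by
    intro j j₁ j₂ h
    have hcard : (Finset.univ.image z).card ≤ (maximalIdeal S).spanFinrank :=
      Finset.card_image_le.trans (by simp [hfr])
    have hspan'' : Ideal.span ((Finset.univ.image z : Finset S) : Set S) = maximalIdeal S := by
      rw [← hspan, Finset.coe_image, Finset.coe_univ, Set.image_univ]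
    refine not_mem_sq_of_span_eq_maximalIdeal _ hspan'' hcard
      (Finset.mem_image_of_mem z (Finset.mem_univ j)) ?_
    rw [h, pow_two]
    exact Ideal.mul_mem_mul (hzm j₁) (hzm j₂)
  have hdomS : ∀ r : S, ¬ IsUnit r → O.valuation (r : K) < 1 := fun r hr =>
    lt_of_le_of_ne ((O.valuation_le_one_iff _).mpr (hSO' _ r.2)) fun h => hr ((hunit r).mpr h)
  have h2d : 2 ≤ d := by
    have hnt : Nontrivial (Fin d) := ⟨⟨a, b, hab⟩⟩
    have := Fintype.one_lt_card_iff_nontrivial.mpr hnt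
    rw [Fintype.card_fin] at this
    omega
  obtain ⟨l, rfl⟩ := Nat.exists_eq_add_of_le h2d
  have h01 : (Fin.castAdd l (0 : Fin 2)) ≠ Fin.castAdd l 1 := by
    intro h
    have := congrArg Fin.val h
    simp at this
  obtain ⟨σ, hσ0, hσ1⟩ := exists_perm_pair h01 hab
  let z' : Fin (2 + l) → S := z ∘ σ
  let c : Fin 2 → S := fun j => z' (Fin.castAdd l j)
  let w : Fin l → S := fun j => z' (Fin.natAdd 2 j)
  have hcw : Fin.append c w = z' := Fin.append_castAdd_natAdd
  have hc0 : ((c 0 : S) : K) = t s := by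
    show ((z (σ (Fin.castAdd l 0)) : S) : K) = t s
    rw [hσ0, hb]
  have hc1 : ((c 1 : S) : K) = t i := by
    show ((z (σ (Fin.castAdd l 1)) : S) : K) = t i
    rw [hσ1, ha]
  have hrz' : Set.range z' = Set.range z := σ.surjective.range_comp z
  have hz : Ideal.span (Set.range (Fin.append c w)) = maximalIdeal S := by
    rw [hcw, hrz', hspan]
  let θ : S →+* K := (S.val : S →ₐ[k] K).toRingHom
  have hθ : ∀ r, θ r = (r : K) := fun _ => rfl
  have hθc : θ (c 0) ≠ 0 := by rw [hθ, hc0]; exact hts0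
  have hRO : ∀ r, θ r ∈ O := fun r => hSO' _ r.2
  have hmin : ∀ j, O.valuation (θ (c j)) ≤ O.valuation (θ (c 0)) := by
    refine Fin.forall_fin_two.mpr ⟨le_rfl, ?_⟩
    rw [hθ, hθ, hc0, hc1]
    exact hvi
  have hdom : ∀ r ∈ maximalIdeal S, O.valuation (θ r) < 1 := fun r hr =>
    hdomS r ((IsLocalRing.mem_maximalIdeal r).mp hr)
  let N := chartCentre c 0 θ hθc O hRO hmin
  have hN : N.comap (chartBase c 0) = maximalIdeal S :=
    comap_reesChartBase_chartCentre c 0 θ hθc O hRO hmin hdom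
  let L := Localization.AtPrime N
  let ψ := chartToField c 0 θ hθc
  let Bψ : Subring K := RingHom.range (R := chartRing c 0) (S := K) ψ
  have hmemBψ : ∀ x, x ∈ Bψ ↔ ∃ b, ψ b = x := fun _ => RingHom.mem_range
  let Φ := Literature.AlgebraicGeometry.Resolution.locToField c 0 θ hθc O hRO hmin L
  have he_gen : ψ (chartGen c 0 1) = t i / t s := by
    show chartToField c 0 θ hθc (chartGen c 0 1) = t i / t s
    rw [chartToField_chartGen, hθ, hθ, hc0, hc1]
  obtain ⟨a', jJ, hjJ, hJ, hcov⟩ : ∃ (a' : ℕ) (jJ : Fin a' → {j : Fin 2 // j ≠ 0}),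
      Function.Injective jJ ∧ (∀ q, chartGen c 0 (jJ q).1 ∈ N) ∧
      (O.valuation (t i / t s) < 1 → ∃ q, (jJ q).1 = 1) := by
    by_cases hve : O.valuation (t i / t s) < 1
    · refine ⟨1, fun _ => ⟨1, by decide⟩, Function.injective_of_subsingleton _, fun q => ?_,
        fun _ => ⟨0, rfl⟩⟩
      show chartGen c 0 1 ∈ chartCentre c 0 θ hθc O hRO hmin
      rw [mem_chartCentre_iff, he_gen]
      exact hve
    · exact ⟨0, fun q => Fin.elim0 q, Function.injective_of_subsingleton _, fun q => Fin.elim0 q,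
        fun h => absurd h hve⟩
  have hrsop : IsRsopPart (chartFamily c 0 w L (chartBase c 0) (chartGen c 0) jJ) :=
    isRsopPart_chartFamily_reesChart c 0 w hz hfr N hN L jJ hjJ hJ
  have hc00 : c 0 ≠ 0 := fun h => hθc (by rw [h, map_zero])
  have hψinj : Function.Injective ψ := by
    have hmem := Ideal.mem_span_range_self (f := c) (x := (0 : Fin 2))
    haveI : IsDomain (Localization.Away (c 0)) :=
      IsLocalization.isDomain_localization (powers_le_nonZeroDivisors_of_noZeroDivisors hc00)
    refine (injective_iff_map_eq_zero _).mpr fun x hx => ?_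
    obtain ⟨kk, r, hr⟩ := exists_pow_mul_eq_reesChartBase c 0 x
    have h1 := congrArg ψ hr
    have h2 : ψ (chartBase c 0 r) = θ r := chartToField_reesChartBase c 0 θ hθc r
    rw [map_mul, hx, mul_zero, h2] at h1
    have hr0 : r = 0 := by
      apply Subtype.ext
      rw [← hθ, ← h1]
      rfl
    rw [hr0, map_zero] at hr
    apply reesChart_injective (c 0) hmem
    have h' := congrArg (reesChart (c 0) hmem) hr
    rw [RingHom.map_mul, RingHom.map_pow, reesChart_reesChartBase, map_zero] at h'
    rw [map_zero]
    refine (mul_eq_zero.mp h').resolve_left (pow_ne_zero kk ?_)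
    exact fun h0 => hc00 ((IsLocalization.to_map_eq_zero_iff (S := Localization.Away (c 0))
      (powers_le_nonZeroDivisors_of_noZeroDivisors hc00)).mp h0)
  have hΦinj : Function.Injective Φ := by
    rw [injective_iff_map_eq_zero]
    intro x hx
    obtain ⟨⟨y, sy⟩, rfl⟩ := IsLocalization.mk'_surjective N.primeCompl x
    have hx' : ψ y / ψ sy = 0 := by
      rw [← hx]
      exact (locToField_mk' c 0 θ hθc O hRO hmin L y sy).symm
    have hsy : ψ (sy : chartRing c 0) ≠ 0 :=
      ne_zero_of_valuation_eq_one ((not_mem_chartCentre_iff c 0 θ hθc O hRO hmin sy.1).mp sy.2)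
    have hy : y = 0 := hψinj (by rw [map_zero]; exact (div_eq_zero_iff.mp hx').resolve_right hsy)
    rw [hy]
    exact IsLocalization.mk'_zero _
  let S₁ : Subalgebra k K :=
    { carrier := Set.range Φ
      mul_mem' := by
        rintro _ _ ⟨x, rfl⟩ ⟨y, rfl⟩
        exact ⟨x * y, map_mul Φ x y⟩
      one_mem' := ⟨1, map_one Φ⟩
      add_mem' := by
        rintro _ _ ⟨x, rfl⟩ ⟨y, rfl⟩
        exact ⟨x + y, map_add Φ x y⟩
      zero_mem' := ⟨0, map_zero Φ⟩
      algebraMap_mem' := fun x => ⟨algebraMap _ L (chartBase c 0 (algebraMap k S x)), by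
          rw [Literature.AlgebraicGeometry.Resolution.locToField_algebraMap, chartToField_reesChartBase]; rfl⟩ }
  have hmemS₁ : ∀ y, y ∈ S₁ ↔ ∃ x, Φ x = y := fun _ => Iff.rfl
  have hrange : RingHom.range (R := L) (S := K) Φ = locAtCentre Bψ O :=
    Literature.AlgebraicGeometry.Resolution.range_locToField c 0 θ hθc O hRO hmin L
  have hS₁loc : ∀ y, y ∈ S₁ ↔ y ∈ locAtCentre Bψ O := fun y => by
    rw [← hrange, RingHom.mem_range]
    exact hmemS₁ y
  let Φ' : L →+* S₁ :=
    { toFun := fun x => ⟨Φ x, x, rfl⟩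
      map_one' := Subtype.ext (map_one Φ)
      map_mul' := fun x y => Subtype.ext (map_mul Φ x y)
      map_zero' := Subtype.ext (map_zero Φ)
      map_add' := fun x y => Subtype.ext (map_add Φ x y) }
  have hΦ'bij : Function.Bijective Φ' := by
    refine ⟨fun x y h => hΦinj (congrArg Subtype.val h), fun y => ?_⟩
    obtain ⟨x, hx⟩ := (hmemS₁ y).mp y.2
    exact ⟨x, Subtype.ext hx⟩
  let e₁ : L ≃+* S₁ := RingEquiv.ofBijective Φ' hΦ'bij
  have he₁ : ∀ x, ((e₁ x : S₁) : K) = Φ x := fun _ => rfl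
  have hSS₁ : S ≤ S₁ := fun x hx => ⟨algebraMap _ L (chartBase c 0 ⟨x, hx⟩), by
    rw [Literature.AlgebraicGeometry.Resolution.locToField_algebraMap, chartToField_reesChartBase]; rfl⟩
  have heS₁ : t i / t s ∈ S₁ := ⟨algebraMap _ L (chartGen c 0 1), by
    rw [Literature.AlgebraicGeometry.Resolution.locToField_algebraMap]; exact he_gen⟩
  have hψO : Bψ ≤ O.toSubring := by
    rintro _ ⟨x, rfl⟩
    exact chartToField_mem c 0 θ hθc O hRO hmin x
  have hS₁O : ∀ y ∈ S₁, y ∈ O := fun y hy => locAtCentre_le hψO ((hS₁loc y).mp hy)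
  have hgenF : ∀ y, y ∈ (Set.range θ ∪ Set.range fun j => θ (c j) / θ (c 0)) → y ∈ F₁ := by
    rintro y (⟨r, rfl⟩ | ⟨j, rfl⟩)
    · exact hSF r.2
    · exact div_mem (hSF (c j).2) (hSF (c 0).2)
  have hBF : ∀ x ∈ Bψ, x ∈ F₁ := by
    intro x hx
    have hx' : x ∈ Subring.closure (Set.range θ ∪ Set.range fun j => θ (c j) / θ (c 0)) := by
      rw [← range_chartToField]; exact hx
    exact (Subring.closure_le (t := F₁.toSubfield.toSubring)).mpr hgenF hx'
  have hS₁F : ∀ y ∈ S₁, y ∈ F₁ := by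
    intro y hy
    obtain ⟨y₁, hy₁, z₁, hz₁, -, rfl⟩ := (hS₁loc y).mp hy
    exact div_mem (hBF y₁ hy₁) (hBF z₁ hz₁)
  have hunit₁ : ∀ r : S₁, IsUnit r ↔ O.valuation (r : K) = 1 := by
    intro r
    constructor
    · intro hr
      obtain ⟨u, hu⟩ := hr.exists_right_inv
      have hrO : IsUnit (⟨(r : K), hS₁O _ r.2⟩ : O) :=
        isUnit_iff_exists_inv.mpr ⟨⟨((u : S₁) : K), hS₁O _ u.2⟩,
          Subtype.ext (by
            have := congrArg (fun x : S₁ => (x : K)) hu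
            simpa using this)⟩
      exact (O.valuation_eq_one_iff _).mp hrO
    · intro hr
      have hr0 : (r : K) ≠ 0 := ne_zero_of_valuation_eq_one hr
      have hinv : (r : K)⁻¹ ∈ S₁ :=
        (hS₁loc _).mpr (inv_mem_locAtCentre ((hS₁loc _).mp r.2) hr)
      exact isUnit_iff_exists_inv.mpr ⟨⟨(r : K)⁻¹, hinv⟩, Subtype.ext (mul_inv_cancel₀ hr0)⟩
  obtain ⟨G, hG⟩ := hCfg
  let C₁ : Subalgebra k K := Algebra.adjoin k (insert (t i / t s) (G : Set K))
  have hC₁fg : C₁.FG := ⟨insert (t i / t s) G, by rw [Finset.coe_insert]⟩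
  have hCC₁ : C ≤ C₁ := by
    rw [← hG]
    exact Algebra.adjoin_mono (Set.subset_insert _ _)
  have heC₁ : t i / t s ∈ C₁ := Algebra.subset_adjoin (Set.mem_insert _ _)
  have hC₁S₁ : C₁ ≤ S₁ := by
    refine Algebra.adjoin_le ?_
    rintro x (rfl | hx)
    · exact heS₁
    · exact hSS₁ (hCS (by rw [← hG]; exact Algebra.subset_adjoin hx))
  have hcj : ∀ j : Fin 2, θ (c j) / θ (c 0) ∈ C₁ := by
    refine Fin.forall_fin_two.mpr ⟨?_, ?_⟩
    · rw [div_self hθc]; exact C₁.one_mem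
    · rw [hθ, hθ, hc0, hc1]; exact heC₁
  have hrepC : ∀ x, x ∈ Subring.closure (Set.range θ ∪ Set.range fun j => θ (c j) / θ (c 0)) →
      ∃ A ∈ C₁, ∃ β ∈ C₁, O.valuation β = 1 ∧ x * β = A := by
    intro x hx
    induction hx using Subring.closure_induction with
    | mem x hx =>
      rcases hx with ⟨r, rfl⟩ | ⟨j, rfl⟩
      · obtain ⟨A, hA, β, hβ, hvβ, hr⟩ := hCrep (r : K) r.2
        exact ⟨A, hCC₁ hA, β, hCC₁ hβ, hvβ, hr⟩
      · exact ⟨θ (c j) / θ (c 0), hcj j, 1, C₁.one_mem, by simp, by simp⟩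
    | zero => exact ⟨0, C₁.zero_mem, 1, C₁.one_mem, by simp, by simp⟩
    | one => exact ⟨1, C₁.one_mem, 1, C₁.one_mem, by simp, by simp⟩
    | add x y _ _ hx hy =>
      obtain ⟨A₁, hA₁, β₁, hβ₁, hv₁, h₁⟩ := hx
      obtain ⟨A₂, hA₂, β₂, hβ₂, hv₂, h₂⟩ := hy
      exact ⟨A₁ * β₂ + A₂ * β₁, C₁.add_mem (C₁.mul_mem hA₁ hβ₂) (C₁.mul_mem hA₂ hβ₁), β₁ * β₂,
        C₁.mul_mem hβ₁ hβ₂, by rw [map_mul, hv₁, hv₂, mul_one], by rw [← h₁, ← h₂]; ring⟩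
    | neg x _ hx =>
      obtain ⟨A, hA, β, hβ, hv, h⟩ := hx
      exact ⟨-A, C₁.neg_mem hA, β, hβ, hv, by rw [← h]; ring⟩
    | mul x y _ _ hx hy =>
      obtain ⟨A₁, hA₁, β₁, hβ₁, hv₁, h₁⟩ := hx
      obtain ⟨A₂, hA₂, β₂, hβ₂, hv₂, h₂⟩ := hy
      exact ⟨A₁ * A₂, C₁.mul_mem hA₁ hA₂, β₁ * β₂, C₁.mul_mem hβ₁ hβ₂,
        by rw [map_mul, hv₁, hv₂, mul_one], by rw [← h₁, ← h₂]; ring⟩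
  have hrepB : ∀ x ∈ Bψ, ∃ A ∈ C₁, ∃ β ∈ C₁, O.valuation β = 1 ∧ x * β = A := fun x hx =>
    hrepC x (by rw [← range_chartToField]; exact hx)
  have hrep₁ : ∀ r ∈ S₁, ∃ A ∈ C₁, ∃ β ∈ C₁, O.valuation β = 1 ∧ r * β = A := by
    intro r hr
    obtain ⟨y, hy, zz, hzz, hvz, rfl⟩ := (hS₁loc r).mp hr
    obtain ⟨Ay, hAy, βy, hβy, hvβy, hy'⟩ := hrepB y hy
    obtain ⟨Az, hAz, βz, hβz, hvβz, hz'⟩ := hrepB zz hzz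
    have hzz0 : zz ≠ 0 := ne_zero_of_valuation_eq_one hvz
    refine ⟨Ay * βz, C₁.mul_mem hAy hβz, Az * βy, C₁.mul_mem hAz hβy, ?_, ?_⟩
    · rw [map_mul, ← hz', map_mul, hvz, hvβz, hvβy, mul_one, mul_one]
    · rw [← hy', ← hz']
      calc y / zz * (zz * βz * βy) = (y / zz * zz) * (βz * βy) := by ring
        _ = y * (βz * βy) := by rw [div_mul_cancel₀ y hzz0]
        _ = y * βy * βz := by ring
  have hreg₁ : IsRegularLocalRing S₁ := by
    haveI := hrsop.1
    exact IsRegularLocalRing.of_ringEquiv e₁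
  have hS₁chart : RegChart O F₁ S₁ :=
    ⟨hreg₁, fun y hy => hS₁O y (Subalgebra.mem_toSubring.mp hy), fun y hy => hS₁F y hy, hunit₁,
      fun y hy => by
        obtain ⟨a₁, ha₁, b₁, hb₁, hb0, hab₁⟩ := hfrac y hy
        exact ⟨a₁, hSS₁ ha₁, b₁, hSS₁ hb₁, hb0, hab₁⟩,
      C₁, hC₁fg, hC₁S₁, hrep₁⟩
  obtain ⟨hregL, e', y, hdimL, hspanL⟩ := hrsop
  let ζ := chartFamily c 0 w L (chartBase c 0) (chartGen c 0) jJ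
  let z₁ : Fin ((a' + l + 1) + e') → S₁ := fun q => e₁ (Fin.append ζ y q)
  have hz₁K : ∀ q, (z₁ q : K) = Φ (Fin.append ζ y q) := fun _ => rfl
  have hζ0 : Φ (ζ 0) = t s := by
    show Φ (chartFamily c 0 w L (chartBase c 0) (chartGen c 0) jJ 0) = t s
    rw [chartFamily, Fin.cons_zero, Literature.AlgebraicGeometry.Resolution.locToField_algebraMap, chartToField_reesChartBase, hθ, hc0]
  have hζe : ∀ q, Φ (ζ (Fin.succ (Fin.castAdd l q))) = θ (c (jJ q).1) / θ (c 0) := by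
    intro q
    show Φ (chartFamily c 0 w L (chartBase c 0) (chartGen c 0) jJ (Fin.succ (Fin.castAdd l q))) = _
    rw [chartFamily, Fin.cons_succ, Fin.append_left, Literature.AlgebraicGeometry.Resolution.locToField_algebraMap, chartToField_chartGen]
  have hζw : ∀ q, Φ (ζ (Fin.succ (Fin.natAdd a' q))) = ((w q : S) : K) := by
    intro q
    show Φ (chartFamily c 0 w L (chartBase c 0) (chartGen c 0) jJ (Fin.succ (Fin.natAdd a' q))) = _
    rw [chartFamily, Fin.cons_succ, Fin.append_right, Literature.AlgebraicGeometry.Resolution.locToField_algebraMap,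
      chartToField_reesChartBase]
    rfl
  have hspanL' : Ideal.span (Set.range (Fin.append ζ y)) = maximalIdeal L := by
    rw [range_fin_append]; exact hspanL
  have hkey : ∀ j, j ≠ i → O.valuation (t j) < 1 → t i / t s ≠ t j := by
    intro j hji hvj h
    rcases htz j with ⟨m', hm'⟩ | hv1
    · apply hnsq a m' b
      apply Subtype.ext
      rw [Subalgebra.coe_mul, ha, hm', hb, ← h, div_mul_cancel₀ _ hts0]
    · exact absurd hv1 (ne_of_lt hvj)
  have hdist₁ : NonunitDistinct O (Function.update t i (t i / t s)) := by
    intro j l' hvj hjl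
    by_cases hji : j = i <;> by_cases hli : l' = i
    · rw [hji, hli]
    · exfalso
      rw [hji, Function.update_self, Function.update_of_ne hli] at hjl
      rw [hji, Function.update_self] at hvj
      have hvl : O.valuation (t l') < 1 := by rw [← hjl]; exact hvj
      exact hkey l' hli hvl hjl
    · exfalso
      rw [hli, Function.update_self, Function.update_of_ne hji] at hjl
      rw [Function.update_of_ne hji] at hvj
      exact hkey j hji hvj hjl.symm
    · rw [Function.update_of_ne hji, Function.update_of_ne hli] at hjl
      rw [Function.update_of_ne hji] at hvj
      exact hdt j l' hvj hjl
  refine ⟨S₁, hSS₁, hS₁chart, ⟨?_, (a' + l + 1) + e', z₁, ?_, ?_, ?_, ?_⟩, hdist₁⟩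
  · intro j
    by_cases hji : j = i
    · rw [hji, Function.update_self]
      exact ⟨heS₁, div_ne_zero hti0 hts0⟩
    · rw [Function.update_of_ne hji]
      exact ⟨hSS₁ (ht1 j).1, (ht1 j).2⟩
  · rw [← ringKrullDim_eq_of_ringEquiv e₁]
    exact hdimL
  · intro q hu
    have hxm : Fin.append ζ y q ∈ maximalIdeal L := by
      rw [← hspanL']
      exact Ideal.subset_span ⟨q, rfl⟩
    exact (IsLocalRing.mem_maximalIdeal _).mp hxm ((isUnit_map_iff e₁ _).mp hu)
  · intro r hr
    have hx : e₁.symm r ∈ maximalIdeal L := by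
      refine (IsLocalRing.mem_maximalIdeal _).mpr fun hu => hr ?_
      have := (isUnit_map_iff e₁ (e₁.symm r)).mpr hu
      rwa [RingEquiv.apply_symm_apply] at this
    rw [← hspanL'] at hx
    have h2 := Ideal.mem_map_of_mem (e₁ : L →+* S₁) hx
    rw [Ideal.map_span, ← Set.range_comp] at h2
    have h3 : (e₁ : L →+* S₁) (e₁.symm r) = r := by
      rw [RingHom.coe_coe, RingEquiv.apply_symm_apply]
    rw [h3] at h2
    exact h2
  · intro j
    by_cases hji : j = i
    · rw [hji, Function.update_self]
      by_cases hve : O.valuation (t i / t s) < 1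
      · obtain ⟨q, hq⟩ := hcov hve
        left
        refine ⟨Fin.castAdd e' (Fin.succ (Fin.castAdd l q)), ?_⟩
        rw [hz₁K, Fin.append_left, hζe, hq, hθ, hθ, hc0, hc1]
      · right
        exact le_antisymm ((O.valuation_le_one_iff _).mpr (hS₁O _ heS₁)) (not_lt.mp hve)
    · rw [Function.update_of_ne hji]
      rcases htz j with ⟨m', hm'⟩ | hv1
      · left
        have hvj : O.valuation (t j) < 1 := by rw [← hm']; exact hdomS _ (hzu m')
        have hm'a : m' ≠ a := by
          rintro rfl
          exact hji (hdt j i hvj (hm'.symm.trans ha))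
        by_cases hm'b : m' = b
        · refine ⟨Fin.castAdd e' 0, ?_⟩
          rw [hz₁K, Fin.append_left, hζ0, ← hm', hm'b, hb]
        · obtain ⟨q, hq⟩ : ∃ q : Fin l, σ (Fin.natAdd 2 q) = m' := by
            have hm'' : σ.symm m' ≠ Fin.castAdd l 0 ∧ σ.symm m' ≠ Fin.castAdd l 1 := by
              constructor
              · intro h; apply hm'b
                have := congrArg σ h
                rw [Equiv.apply_symm_apply, hσ0] at this
                exact this
              · intro h; apply hm'a
                have := congrArg σ h
                rw [Equiv.apply_symm_apply, hσ1] at this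
                exact this
            have hx' : σ (σ.symm m') = m' := Equiv.apply_symm_apply σ m'
            generalize σ.symm m' = x at hm'' hx'
            induction x using Fin.addCases with
            | left j₂ =>
              exact ((Fin.forall_fin_two (p := fun j₂ : Fin 2 =>
                  Fin.castAdd l j₂ ≠ Fin.castAdd l 0 → Fin.castAdd l j₂ ≠ Fin.castAdd l 1 → False)).mpr
                ⟨fun h _ => h rfl, fun _ h => h rfl⟩ j₂ hm''.1 hm''.2).elim
            | right q => exact ⟨q, hx'⟩
          refine ⟨Fin.castAdd e' (Fin.succ (Fin.natAdd a' q)), ?_⟩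
          rw [hz₁K, Fin.append_left, hζw, ← hm', ← hq]
          rfl
      · right
        exact hv1

end PartVII
end Summit.ResolutionOfSingularities.ResolutionOfSingularities.Theorems.DefectlessLadder
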